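import Summits.BirchSwinnertonDyer.BirchSwinnertonDyer.Theorems.Rank2ObservatoryRootNumberCert
import Summits.BirchSwinnertonDyer.BirchSwinnertonDyer.Theorems.Rank2ObservatoryRank3Table
import HarnessLib

/-!
# BSD rank ≥ 2 observatory (`b2b-bsdr2`): root-number certificates for the rank-3 census — schema

HONEST FRAMING: per-curve certified theorems and census instruments; no claim on BSD in rank ≥ 2.

Glue between the census rows (`Rank3Row`, `Rank2ObservatoryRank3Table`) and the root-number
certificates (`RNCert`, `Rank2ObservatoryRootNumberCert`): the row's integer model
`Rank3Row.intModel` (`r.curve = r.intModel ⊗ ℚ`), the aligned chunk check `rnRowsCheck` decided by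
the kernel in the 27 data chunks `Rank2ObservatoryRank3RootNumberCertsNN`, the row predicate
`Rank3Row.RootNumberCertified` it establishes, and `w(E) = −1` for a certified row GIVEN the tree's
named fact `WeierstrassCurve.rootNumber_eq_neg_finprod_tableLocalRootNumberAt'` (Kellock–Dokchitser
2023, Thm. 2.3 + §5 table, rows `(0,5,2)` corrected) as a hypothesis.

References: Kellock–Dokchitser 2023 [KellockDokchitser2023]; Rohrlich 1993 [Rohrlich1993Compositio];
J. E. Cremona, *Algorithms for Modular Elliptic Curves* (1997), Tables [CremonaAlgorithms1997].
-/

set_option linter.dupNamespace false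
set_option autoImplicit false

open WeierstrassCurve

namespace Summit.BirchSwinnertonDyer.BirchSwinnertonDyer.Rank2Observatory

open RootNumber

/-- The row's Weierstrass equation over `ℤ` (Cremona's minimal model `[a₁,a₂,a₃,a₄,a₆]`).
[cite: CremonaAlgorithms1997, Tables] -/
def Rank3Row.intModel (r : Rank3Row) : WeierstrassCurve ℤ := ⟨r.a₁, r.a₂, r.a₃, r.a₄, r.a₆⟩

/-- The row's curve over `ℚ` is the base change of its integer model. [folklore] -/
theorem Rank3Row.curve_eq_baseChange (r : Rank3Row) : r.curve = r.intModel.baseChange ℚ := by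
  ext <;> simp [Rank3Row.curve, Rank3Row.intModel, baseChange, WeierstrassCurve.map]

/-- A row is ROOT-NUMBER CERTIFIED if some certificate checks on its integer model with certified
product `+1` (i.e. `w = −1` by the named fact). [folklore] -/
def Rank3Row.RootNumberCertified (r : Rank3Row) : Prop :=
  ∃ c : RNCert, c.check r.intModel = true ∧ c.sign r.intModel = 1

/-- **`w(E) = −1` for a root-number-certified row, modulo the named fact**
`rootNumber_eq_neg_finprod_tableLocalRootNumberAt'` (Kellock–Dokchitser 2023 Thm. 2.3 + §5,
corrected; hypothesis `hKD`). [cite: KellockDokchitser2023, Thm. 2.3 and §5] -/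
theorem Rank3Row.rootNumber_eq_neg_one_of_certified {r : Rank3Row} (h : r.RootNumberCertified)
    (hKD : r.curve.rootNumber_eq_neg_finprod_tableLocalRootNumberAt') : r.curve.rootNumber = -1 := by
  obtain ⟨c, hc, hs⟩ := h
  rw [Rank3Row.curve_eq_baseChange] at hKD ⊢
  rw [rootNumber_eq_neg_sign hc hKD, hs]

/-- The aligned chunk check: same length, and every `some c` checks on its row with `sign = 1`
(`none` = row not certified here: an odd prime of additive reduction). [folklore] -/
def rnRowsCheck : List Rank3Row → List (Option RNCert) → Bool
  | [], [] => true
  | _ :: rs, none :: cs => rnRowsCheck rs cs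
  | r :: rs, some c :: cs => (c.check r.intModel && (c.sign r.intModel == 1)) && rnRowsCheck rs cs
  | _, _ => false

/-- A passing chunk check has aligned lengths. [folklore] -/
theorem length_eq_of_rnRowsCheck :
    ∀ (rows : List Rank3Row) (certs : List (Option RNCert)), rnRowsCheck rows certs = true →
      rows.length = certs.length
  | [], [], _ => rfl
  | [], _ :: _, h => by simp [rnRowsCheck] at h
  | _ :: _, [], h => by simp [rnRowsCheck] at h
  | _ :: rs, none :: cs, h => by
    simp only [rnRowsCheck] at h
    simp [length_eq_of_rnRowsCheck rs cs h]
  | r :: rs, some c :: cs, h => by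
    simp only [rnRowsCheck, Bool.and_eq_true] at h
    simp [length_eq_of_rnRowsCheck rs cs h.2]

/-- What a passing chunk check says about row `i`. [folklore] -/
theorem certified_of_rnRowsCheck :
    ∀ (rows : List Rank3Row) (certs : List (Option RNCert)), rnRowsCheck rows certs = true →
      ∀ (i : ℕ) (hi : i < rows.length) (c : RNCert), certs[i]? = some (some c) →
        (rows[i]'hi).RootNumberCertified
  | [], _, _, i, hi, _, _ => absurd hi (Nat.not_lt_zero i)
  | _ :: _, [], h, _, _, _, _ => by simp [rnRowsCheck] at h
  | r :: rs, none :: cs, h, i, hi, c, hc => by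
    cases i with
    | zero => simp at hc
    | succ i =>
      simp only [rnRowsCheck] at h
      simp only [List.getElem?_cons_succ] at hc
      simpa using certified_of_rnRowsCheck rs cs h i (by simpa using hi) c hc
  | r :: rs, some c' :: cs, h, i, hi, c, hc => by
    simp only [rnRowsCheck, Bool.and_eq_true, beq_iff_eq] at h
    cases i with
    | zero =>
      simp only [List.getElem?_cons_zero, Option.some.injEq] at hc
      subst hc
      exact ⟨c', h.1.1, h.1.2⟩
    | succ i =>
      simp only [List.getElem?_cons_succ] at hc
      simpa using certified_of_rnRowsCheck rs cs h.2 i (by simpa using hi) c hc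

/-- Chunk checks concatenate. [folklore] -/
theorem rnRowsCheck_append :
    ∀ (a : List Rank3Row) (b : List (Option RNCert)) (a' : List Rank3Row) (b' : List (Option RNCert)),
      rnRowsCheck a b = true → rnRowsCheck a' b' = true → rnRowsCheck (a ++ a') (b ++ b') = true
  | [], [], _, _, _, h' => by simpa using h'
  | [], _ :: _, _, _, h, _ => by simp [rnRowsCheck] at h
  | _ :: _, [], _, _, h, _ => by simp [rnRowsCheck] at h
  | r :: rs, none :: cs, a', b', h, h' => by
    simp only [rnRowsCheck] at h
    simpa [rnRowsCheck] using rnRowsCheck_append rs cs a' b' h h'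
  | r :: rs, some c :: cs, a', b', h, h' => by
    simp only [rnRowsCheck, Bool.and_eq_true] at h
    simp only [List.cons_append, rnRowsCheck, Bool.and_eq_true]
    exact ⟨h.1, rnRowsCheck_append rs cs a' b' h.2 h'⟩

/-- A row listed with a certificate in a passing chunk is root-number certified (membership form).
[folklore] -/
theorem certified_of_mem_zip {rows : List Rank3Row} {certs : List (Option RNCert)}
    (h : rnRowsCheck rows certs = true) {r : Rank3Row} {c : RNCert}
    (hm : (r, some c) ∈ rows.zip certs) : r.RootNumberCertified := by
  obtain ⟨i, hi, hget⟩ := List.getElem_of_mem hm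
  rw [List.length_zip] at hi
  have hi1 : i < rows.length := lt_of_lt_of_le hi (min_le_left _ _)
  have hi2 : i < certs.length := lt_of_lt_of_le hi (min_le_right _ _)
  rw [List.getElem_zip] at hget
  obtain ⟨rfl, hc⟩ := Prod.mk.inj hget
  exact certified_of_rnRowsCheck rows certs h i hi1 c (by rw [List.getElem?_eq_getElem hi2, hc])

end Summit.BirchSwinnertonDyer.BirchSwinnertonDyer.Rank2Observatory
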